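import Summits.NavierStokesRegularity.NavierStokesRegularity.Theses.FilamentSkeletonRss

/-!
# `SkeletonEquilibrium` (stmt-NavierStokesRegularity-15400): the strain identity every witness obeys

Negative-side support for the crux `FilamentSkeletonRss.SkeletonEquilibrium` (relative equilibria of
vortex filaments under the regularised Biot–Savart law in the rotating Leray frame
`V_α y = ½ y − α e₃ × y`, with a unique SUPERCRITICAL stagnation point `w_j′(τ*) ≥ 3/2 + δ` on every
filament), from the cdisprove work file `Cruxes/SkeletonEquilibrium/Disproof.lean` §(b) (seat
refuter-cdisprove-stmt-NavierStokesRegularity-15400-0, 2026-08-16). Companion of the landed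
`…Theorems.CoreGluing.Negative.ThresholdLoadBearing` (the supercritical threshold is the ONLY
load-bearing clause: below the Leray rate `½` the bare rotation axis inhabits everything) and
`…Theorems.CoreGluing.Negative.ParallelLinesSubcritical` (axis-parallel arrays have `w′ ≡ ½`).
This file explains both at once and says where ANY proof must find the missing `1 + δ`:

* `strain_identity` — for a unit-speed `C²` curve `Ξ` carrying a differentiable "induced velocity"
  `F` with `F + V_α(Ξ) = w Ξ′` (tangency with slip `w`), `w′ = ½ + ⟪F′, Ξ′⟫` IDENTICALLY: the Leray
  stretching contributes exactly `½`, the frame rotation nothing (`⟪e₃ × T, T⟫ = 0`), the curvature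
  nothing (`⟪Ξ′, Ξ″⟫ = 0`). Nothing about HOW `F` is induced enters.
* `witness_slope_eq` — specialised to the crux's own data: from the per-filament clauses (C², unit
  speed, `w_j` differentiable) and the relative-equilibrium system alone, the skeleton's regularised
  Biot–Savart velocity along filament `j` is differentiable (it equals `w_j Ξ_j′ − V_α(Ξ_j)`) and
  `w_j′(τ) = ½ + ⟪(u_skel ∘ Ξ_j)′(τ), Ξ_j′(τ)⟫`.
* `witness_axial_strain_ge` — hence the supercritical clause `c + δ ≤ w_j′(τ*)` is EXACTLY the demand
  that the skeleton's own field have axial strain `≥ c + δ − ½` along the filament at the stagnation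
  point (`≥ 1 + δ` for the crux, `c = 3/2`). Consequences for both sides: every configuration class
  whose induced velocity is axially constant along the filaments is dead at slope `½` (a single
  straight filament: self-induction `≡ 0`; axis-parallel arrays = 2-D relative equilibria; the pure
  outer balance of local induction against the drift, where `F ∥` binormal); supercriticality must be
  manufactured as genuine axial strain — skew mutual induction at the `√Γ` waist (the 2001 `C₃`
  triple / cages, the ideators' certified `C₄` datum) or self-strain of a folded filament — and a
  disproof would have to bound that strain by `1` at every stagnation point of every equilibrium
  (a rotating-frame Hormoz–Brenner theorem, not in print).
-/

set_option linter.dupNamespace false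

namespace Summit.NavierStokesRegularity.NavierStokesRegularity.Theorems.SkeletonEquilibrium.Negative

open Literature.Analysis.FluidPDE MeasureTheory
open scoped RealInnerProductSpace InnerProductSpace BigOperators

/-- `⟪a × b, b⟫ = 0` (private copy of the triple-product identity; the tree survivor
`Literature…TaoAveragedNondegeneracy.inner_cross_self_right` sits behind heavy unrelated imports).
[folklore] -/
private theorem inner_cross_self_right (a b : EuclideanSpace ℝ (Fin 3)) : ⟪cross a b, b⟫ = 0 := by
  simp only [cross, PiLp.inner_apply, RCLike.inner_apply, conj_trivial, Fin.sum_univ_three,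
    cross_apply, Matrix.cons_val_zero, Matrix.cons_val_one, Matrix.cons_val_two,
    Matrix.head_cons, Matrix.tail_cons]
  ring

/-- The drift `V_α(Ξ)` along a differentiable curve has derivative `V_α(Ξ′)` (linearity of
`y ↦ ½ y − α e₃ × y`). [folklore] -/
private theorem hasDerivAt_drift {α : ℝ} {Ξ : ℝ → EuclideanSpace ℝ (Fin 3)}
    {T : EuclideanSpace ℝ (Fin 3)} {τ : ℝ} (hΞ : HasDerivAt Ξ T τ) :
    HasDerivAt (fun σ => (1 / 2 : ℝ) • Ξ σ - α • cross (EuclideanSpace.single (2 : Fin 3) (1 : ℝ)) (Ξ σ))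
      ((1 / 2 : ℝ) • T - α • cross (EuclideanSpace.single (2 : Fin 3) (1 : ℝ)) T) τ := by
  set L : EuclideanSpace ℝ (Fin 3) →L[ℝ] EuclideanSpace ℝ (Fin 3) :=
    (1 / 2 : ℝ) • ContinuousLinearMap.id ℝ _ - α • crossCLM (EuclideanSpace.single (2 : Fin 3) (1 : ℝ))
    with hL
  have hLapp : ∀ y, L y = (1 / 2 : ℝ) • y - α • cross (EuclideanSpace.single (2 : Fin 3) (1 : ℝ)) y :=
    fun y => by simp [hL, crossCLM_apply]
  have h := L.hasFDerivAt.comp_hasDerivAt τ hΞ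
  have hfun : (fun σ => (1 / 2 : ℝ) • Ξ σ - α • cross (EuclideanSpace.single (2 : Fin 3) (1 : ℝ)) (Ξ σ))
      = L ∘ Ξ := by
    funext σ; simp [hLapp]
  rw [hfun, ← hLapp]
  exact h

/-- **Strain identity.** Let `Ξ` be a unit-speed `C²` curve, `F` differentiable, `w` arbitrary, with
the tangency relation `F(τ) + ½ Ξ(τ) − α e₃ × Ξ(τ) = w(τ) Ξ′(τ)` of the crux (there `F` is the
skeleton's regularised Biot–Savart velocity along the filament). Then for every `τ`,
`w′(τ) = ½ + ⟪F′(τ), Ξ′(τ)⟫`: the Leray stretching gives exactly `½`, the rotation and the curvature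
give nothing. [folklore] -/
theorem strain_identity {α : ℝ} {Ξ F : ℝ → EuclideanSpace ℝ (Fin 3)} {w : ℝ → ℝ}
    (hΞ : ContDiff ℝ 2 Ξ) (hunit : ∀ τ, ‖deriv Ξ τ‖ = 1) (hF : Differentiable ℝ F)
    (heq : ∀ τ, F τ + ((1 / 2 : ℝ) • Ξ τ - α • cross (EuclideanSpace.single (2 : Fin 3) (1 : ℝ)) (Ξ τ))
      = w τ • deriv Ξ τ) (τ : ℝ) :
    deriv w τ = 1 / 2 + ⟪deriv F τ, deriv Ξ τ⟫ := by
  have hΞd : Differentiable ℝ Ξ := hΞ.differentiable (by norm_num)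
  have hTd : Differentiable ℝ (deriv Ξ) := hΞ.differentiable_deriv_two
  -- `w = ⟪F + V(Ξ), Ξ′⟫` because `‖Ξ′‖ = 1`
  have hw_eq : w = fun σ => ⟪F σ + ((1 / 2 : ℝ) • Ξ σ -
      α • cross (EuclideanSpace.single (2 : Fin 3) (1 : ℝ)) (Ξ σ)), deriv Ξ σ⟫ := by
    funext σ
    rw [heq σ, real_inner_smul_left, real_inner_self_eq_norm_sq, hunit σ, one_pow, mul_one]
  -- `⟪Ξ′, Ξ″⟫ = 0` from `‖Ξ′‖ ≡ 1`
  have hTT : ⟪deriv Ξ τ, deriv (deriv Ξ) τ⟫ = 0 := by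
    have h1 : (fun σ => ⟪deriv Ξ σ, deriv Ξ σ⟫) = fun _ => (1 : ℝ) := by
      funext σ; rw [real_inner_self_eq_norm_sq, hunit σ, one_pow]
    have h2 : HasDerivAt (fun σ => ⟪deriv Ξ σ, deriv Ξ σ⟫)
        (⟪deriv Ξ τ, deriv (deriv Ξ) τ⟫ + ⟪deriv (deriv Ξ) τ, deriv Ξ τ⟫) τ :=
      (hTd τ).hasDerivAt.inner ℝ (hTd τ).hasDerivAt
    rw [h1] at h2
    have h3 := h2.unique (hasDerivAt_const τ (1 : ℝ))
    rw [real_inner_comm (deriv (deriv Ξ) τ)] at h3 ⊢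
    linarith
  -- differentiate `w = ⟪G, Ξ′⟫`, `G = F + V(Ξ)`
  have hG : HasDerivAt (fun σ => F σ + ((1 / 2 : ℝ) • Ξ σ -
      α • cross (EuclideanSpace.single (2 : Fin 3) (1 : ℝ)) (Ξ σ)))
      (deriv F τ + ((1 / 2 : ℝ) • deriv Ξ τ -
        α • cross (EuclideanSpace.single (2 : Fin 3) (1 : ℝ)) (deriv Ξ τ))) τ :=
    (hF τ).hasDerivAt.add (hasDerivAt_drift (hΞd τ).hasDerivAt)
  have hd : HasDerivAt w (⟪F τ + ((1 / 2 : ℝ) • Ξ τ -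
      α • cross (EuclideanSpace.single (2 : Fin 3) (1 : ℝ)) (Ξ τ)), deriv (deriv Ξ) τ⟫ +
      ⟪deriv F τ + ((1 / 2 : ℝ) • deriv Ξ τ -
        α • cross (EuclideanSpace.single (2 : Fin 3) (1 : ℝ)) (deriv Ξ τ)), deriv Ξ τ⟫) τ := by
    rw [hw_eq]
    exact hG.inner ℝ (hTd τ).hasDerivAt
  rw [hd.deriv, heq τ, real_inner_smul_left, hTT, mul_zero, zero_add, inner_add_left,
    inner_sub_left, real_inner_smul_left, real_inner_smul_left, inner_cross_self_right, mul_zero,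
    sub_zero, real_inner_self_eq_norm_sq, hunit τ, one_pow, mul_one, add_comm]

/-- **Every witness of the crux obeys `w_j′ = ½ + (axial Biot–Savart strain)`.** From the
per-filament clauses (C², unit speed, `w_j` differentiable) and the relative-equilibrium system of
`SkeletonEquilibrium` (any `N, γ, α, Γ`): the skeleton's induced velocity along filament `j`,
`τ ↦ Σ_k (Γγ_k/4π) ∫ ((‖Ξ_j τ − Ξ_k σ‖²+1)^{3/2})⁻¹ Ξ_k′σ × (Ξ_j τ − Ξ_k σ) dσ`, is differentiable and
`w_j′(τ) = ½ + ⟪(its derivative)(τ), Ξ_j′(τ)⟫` for every `τ`. [folklore] -/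
theorem witness_slope_eq {N : ℕ} {γ : Fin N → ℝ} {α Γ : ℝ}
    {Ξ : Fin N → ℝ → EuclideanSpace ℝ (Fin 3)} {w : Fin N → ℝ → ℝ}
    (hC2 : ∀ j, ContDiff ℝ 2 (Ξ j)) (hunit : ∀ j τ, ‖deriv (Ξ j) τ‖ = 1)
    (hw : ∀ j, Differentiable ℝ (w j))
    (heq : ∀ j τ, (∑ k : Fin N, (Γ * γ k / (4 * Real.pi)) • ∫ σ : ℝ,
      ((‖Ξ j τ - Ξ k σ‖ ^ 2 + 1) ^ (3 / 2 : ℝ))⁻¹ • cross (deriv (Ξ k) σ) (Ξ j τ - Ξ k σ)) +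
      (1 / 2 : ℝ) • Ξ j τ - α • cross (EuclideanSpace.single (2 : Fin 3) (1 : ℝ)) (Ξ j τ) =
      w j τ • deriv (Ξ j) τ)
    (j : Fin N) :
    Differentiable ℝ (fun τ => ∑ k : Fin N, (Γ * γ k / (4 * Real.pi)) • ∫ σ : ℝ,
      ((‖Ξ j τ - Ξ k σ‖ ^ 2 + 1) ^ (3 / 2 : ℝ))⁻¹ • cross (deriv (Ξ k) σ) (Ξ j τ - Ξ k σ)) ∧
    ∀ τ, deriv (w j) τ = 1 / 2 + ⟪deriv (fun τ => ∑ k : Fin N, (Γ * γ k / (4 * Real.pi)) • ∫ σ : ℝ,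
      ((‖Ξ j τ - Ξ k σ‖ ^ 2 + 1) ^ (3 / 2 : ℝ))⁻¹ • cross (deriv (Ξ k) σ) (Ξ j τ - Ξ k σ)) τ,
      deriv (Ξ j) τ⟫ := by
  set F : ℝ → EuclideanSpace ℝ (Fin 3) := fun τ => ∑ k : Fin N, (Γ * γ k / (4 * Real.pi)) •
    ∫ σ : ℝ, ((‖Ξ j τ - Ξ k σ‖ ^ 2 + 1) ^ (3 / 2 : ℝ))⁻¹ • cross (deriv (Ξ k) σ) (Ξ j τ - Ξ k σ)
    with hFdef
  have heq' : ∀ τ, F τ + ((1 / 2 : ℝ) • Ξ j τ -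
      α • cross (EuclideanSpace.single (2 : Fin 3) (1 : ℝ)) (Ξ j τ)) = w j τ • deriv (Ξ j) τ := by
    intro τ
    rw [← heq j τ, hFdef, add_sub_assoc]
  have hd : Differentiable ℝ (Ξ j) := (hC2 j).differentiable (by norm_num)
  have hF : Differentiable ℝ F := by
    have hfun : F = fun τ => w j τ • deriv (Ξ j) τ - ((1 / 2 : ℝ) • Ξ j τ -
        α • cross (EuclideanSpace.single (2 : Fin 3) (1 : ℝ)) (Ξ j τ)) := by
      funext τ; rw [← heq' τ, add_sub_cancel_right]
    rw [hfun]
    exact ((hw j).smul (hC2 j).differentiable_deriv_two).sub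
      fun τ => (hasDerivAt_drift (hd τ).hasDerivAt).differentiableAt
  exact ⟨hF, strain_identity (hC2 j) (hunit j) hF heq'⟩

/-- **The quantitative content of (SC).** For any data satisfying the per-filament clauses and the
relative-equilibrium system of the crux, a stagnation point with `c + δ ≤ w_j′(τ*)` forces axial
strain `≥ c + δ − ½` of the skeleton's induced velocity along the filament there (for the crux,
`c = 3/2`: strain `≥ 1 + δ`). In particular data whose induced velocity is axially constant along
filament `j` (zero axial strain) admit no threshold above `½`. [folklore] -/
theorem witness_axial_strain_ge {N : ℕ} {γ : Fin N → ℝ} {α Γ c δ : ℝ}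
    {Ξ : Fin N → ℝ → EuclideanSpace ℝ (Fin 3)} {w : Fin N → ℝ → ℝ}
    (hC2 : ∀ j, ContDiff ℝ 2 (Ξ j)) (hunit : ∀ j τ, ‖deriv (Ξ j) τ‖ = 1)
    (hw : ∀ j, Differentiable ℝ (w j))
    (heq : ∀ j τ, (∑ k : Fin N, (Γ * γ k / (4 * Real.pi)) • ∫ σ : ℝ,
      ((‖Ξ j τ - Ξ k σ‖ ^ 2 + 1) ^ (3 / 2 : ℝ))⁻¹ • cross (deriv (Ξ k) σ) (Ξ j τ - Ξ k σ)) +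
      (1 / 2 : ℝ) • Ξ j τ - α • cross (EuclideanSpace.single (2 : Fin 3) (1 : ℝ)) (Ξ j τ) =
      w j τ • deriv (Ξ j) τ)
    {j : Fin N} {τs : ℝ} (hsc : c + δ ≤ deriv (w j) τs) :
    c + δ - 1 / 2 ≤ ⟪deriv (fun τ => ∑ k : Fin N, (Γ * γ k / (4 * Real.pi)) • ∫ σ : ℝ,
      ((‖Ξ j τ - Ξ k σ‖ ^ 2 + 1) ^ (3 / 2 : ℝ))⁻¹ • cross (deriv (Ξ k) σ) (Ξ j τ - Ξ k σ)) τs,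
      deriv (Ξ j) τs⟫ := by
  have h := (witness_slope_eq hC2 hunit hw heq j).2 τs
  linarith

/-- **Corollary: the crux at any threshold `c > ½` needs nonzero axial strain.** If the induced
velocity along filament `j` has zero axial strain at the stagnation point (e.g. it is constant along
the filament), then `w_j′(τ*) = ½` and the supercritical clause fails for every `δ > 0` and every
`c ≥ ½`. [folklore] -/
theorem not_supercritical_of_zero_axial_strain {N : ℕ} {γ : Fin N → ℝ} {α Γ c δ : ℝ}
    {Ξ : Fin N → ℝ → EuclideanSpace ℝ (Fin 3)} {w : Fin N → ℝ → ℝ}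
    (hC2 : ∀ j, ContDiff ℝ 2 (Ξ j)) (hunit : ∀ j τ, ‖deriv (Ξ j) τ‖ = 1)
    (hw : ∀ j, Differentiable ℝ (w j))
    (heq : ∀ j τ, (∑ k : Fin N, (Γ * γ k / (4 * Real.pi)) • ∫ σ : ℝ,
      ((‖Ξ j τ - Ξ k σ‖ ^ 2 + 1) ^ (3 / 2 : ℝ))⁻¹ • cross (deriv (Ξ k) σ) (Ξ j τ - Ξ k σ)) +
      (1 / 2 : ℝ) • Ξ j τ - α • cross (EuclideanSpace.single (2 : Fin 3) (1 : ℝ)) (Ξ j τ) =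
      w j τ • deriv (Ξ j) τ)
    (hc : 1 / 2 ≤ c) (hδ : 0 < δ) {j : Fin N} {τs : ℝ}
    (hstrain : ⟪deriv (fun τ => ∑ k : Fin N, (Γ * γ k / (4 * Real.pi)) • ∫ σ : ℝ,
      ((‖Ξ j τ - Ξ k σ‖ ^ 2 + 1) ^ (3 / 2 : ℝ))⁻¹ • cross (deriv (Ξ k) σ) (Ξ j τ - Ξ k σ)) τs,
      deriv (Ξ j) τs⟫ = 0) :
    ¬ (c + δ ≤ deriv (w j) τs) := by
  intro hsc
  have h := witness_axial_strain_ge hC2 hunit hw heq hsc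
  rw [hstrain] at h
  linarith

end Summit.NavierStokesRegularity.NavierStokesRegularity.Theorems.SkeletonEquilibrium.Negative
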